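import Summits.ValiantsHypothesis.ValiantsHypothesis.Theorems.FeketeSOSFeketeSOSHardPaleyRIPPairing

/-!
# Route FeketeSOS — crux `FeketeSOSHard` (stmt-ValiantsHypothesis-3996), line `paley-rip` (skeleton v3):
# dual certificates — every Hankel-flat weight `z` bounds the mass of EVERY representation from below

The operator stub `stub_tameOperator` asks for cheap representations (upper bounds on the minimal mass `μ_S`).  Refuting it,
or certifying that a given pattern is EXPENSIVE, goes through the dual side (census `Lines/paley-rip-stub3-census.md` §4–§6):
`μ_S(F) ≥ |Σ_n z(n) F_n| / ‖(z(s+t))_{s,t∈S}‖_op` for every weight `z : ℤ/p → ℂ`.  This file puts the dual bound in kernel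
form, with the operator norm replaced by the (equivalent, for symmetric forms) uniform bound on the restricted quadratic form:

* `norm_pairing_le_of_formBound` — if `|Σ_{a,b ∈ supp w} z(a+b) w_a w_b| ≤ L · Σ_a |w_a|²` for every square `w` of the family,
  then `|Σ_{n<p} z(n) F_n| ≤ L · Σ_j sqMass c_j w_j` for every cyclic pattern `F` of the family (`pairing_of_dvd`, p579447,
  + triangle inequality).  `z = χ_p`, `F = F_p` recovers the mass floors of `…PaleyRIPTameStatus.lean` (`L = √p`, `p^{1/2−κ}`,
  `#S`); a disprover's "expensive pattern" certificate for `stub_tameOperator` is an instance with `|Σ z F| > L·K r^K #S^{1+ε} M`.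
* `norm_pairing_le_of_formBound_on` — the same with the form bound assumed only for vectors supported in a fixed `S`
  containing all the supports.

Honest framing: a two-line consequence of the pairing identity; nothing here proves or refutes the stub, the engine or the crux;
`VP ≠ VNP` untouched.
-/

set_option linter.dupNamespace false

namespace Summit.ValiantsHypothesis.ValiantsHypothesis.Theorems.FeketeSOSHardPaleyRIP

open Polynomial Finset
open scoped BigOperators

noncomputable section

section DualBound

variable (p : ℕ) [Fact p.Prime]

/-- **Dual certificate bound.**  For a cyclic representation `X^p − 1 ∣ Σ_j c_j w_j² − F` (`deg F < p`) and a weight `z` whose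
restricted Hankel form is bounded by `L` on each square, `|Σ_{n<p} z(n) F_n| ≤ L · Σ_j |c_j|‖w_j‖₂²`. [folklore] -/
theorem norm_pairing_le_of_formBound (z : ZMod p → ℂ) (L : ℝ) (s : ℕ) (c : Fin s → ℂ) (w : Fin s → ℂ[X])
    (F : ℂ[X]) (hF : F.natDegree < p) (hdvd : (X : ℂ[X]) ^ p - 1 ∣ (∑ i, C (c i) * w i ^ 2) - F)
    (hform : ∀ i, ‖∑ a ∈ (w i).support, ∑ b ∈ (w i).support,
        z ((a + b : ℕ) : ZMod p) * (w i).coeff a * (w i).coeff b‖ ≤ L * ∑ a ∈ (w i).support, ‖(w i).coeff a‖ ^ 2) :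
    ‖∑ n ∈ range p, z (n : ZMod p) * F.coeff n‖ ≤ L * ∑ i, sqMass (c i) (w i) := by
  rw [pairing_of_dvd p z s c w F hF hdvd]
  calc ‖∑ i, c i * ∑ a ∈ (w i).support, ∑ b ∈ (w i).support,
          z ((a + b : ℕ) : ZMod p) * (w i).coeff a * (w i).coeff b‖
      ≤ ∑ i, ‖c i * ∑ a ∈ (w i).support, ∑ b ∈ (w i).support,
          z ((a + b : ℕ) : ZMod p) * (w i).coeff a * (w i).coeff b‖ := norm_sum_le _ _
    _ = ∑ i, ‖c i‖ * ‖∑ a ∈ (w i).support, ∑ b ∈ (w i).support,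
          z ((a + b : ℕ) : ZMod p) * (w i).coeff a * (w i).coeff b‖ := by simp_rw [norm_mul]
    _ ≤ ∑ i, ‖c i‖ * (L * ∑ a ∈ (w i).support, ‖(w i).coeff a‖ ^ 2) :=
        sum_le_sum fun i _ => mul_le_mul_of_nonneg_left (hform i) (norm_nonneg _)
    _ = L * ∑ i, sqMass (c i) (w i) := by
        rw [mul_sum]; refine sum_congr rfl fun i _ => ?_; unfold sqMass; ring

/-- The same with the form bound hypothesised uniformly for all coefficient vectors on a set `S` containing the supports
(the usual "restricted operator norm ≤ L" hypothesis, in quadratic-form language). [folklore] -/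
theorem norm_pairing_le_of_formBound_on (z : ZMod p → ℂ) (L : ℝ) (S : Finset ℕ) (s : ℕ) (c : Fin s → ℂ)
    (w : Fin s → ℂ[X]) (hw : ∀ i, (w i).support ⊆ S)
    (F : ℂ[X]) (hF : F.natDegree < p) (hdvd : (X : ℂ[X]) ^ p - 1 ∣ (∑ i, C (c i) * w i ^ 2) - F)
    (hform : ∀ v : ℕ → ℂ, (∀ a ∉ S, v a = 0) →
        ‖∑ a ∈ S, ∑ b ∈ S, z ((a + b : ℕ) : ZMod p) * v a * v b‖ ≤ L * ∑ a ∈ S, ‖v a‖ ^ 2) :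
    ‖∑ n ∈ range p, z (n : ZMod p) * F.coeff n‖ ≤ L * ∑ i, sqMass (c i) (w i) := by
  classical
  refine norm_pairing_le_of_formBound p z L s c w F hF hdvd fun i => ?_
  -- extend the double sum from `supp (w i)` to `S` (extra terms vanish) and apply `hform` to the coefficient vector
  have hzero : ∀ a ∉ S, (w i).coeff a = 0 := fun a ha => notMem_support_iff.1 fun h => ha (hw i h)
  have hinner : ∀ a, ∑ b ∈ (w i).support, z ((a + b : ℕ) : ZMod p) * (w i).coeff a * (w i).coeff b =
      ∑ b ∈ S, z ((a + b : ℕ) : ZMod p) * (w i).coeff a * (w i).coeff b := fun a =>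
    Finset.sum_subset (hw i) fun b _ hb => by rw [notMem_support_iff.1 hb, mul_zero]
  have hdouble : ∑ a ∈ (w i).support, ∑ b ∈ (w i).support, z ((a + b : ℕ) : ZMod p) * (w i).coeff a * (w i).coeff b =
      ∑ a ∈ S, ∑ b ∈ S, z ((a + b : ℕ) : ZMod p) * (w i).coeff a * (w i).coeff b := by
    rw [Finset.sum_congr rfl fun a _ => hinner a]
    exact Finset.sum_subset (hw i) fun a _ ha => Finset.sum_eq_zero fun b _ => by
      rw [notMem_support_iff.1 ha, mul_zero, zero_mul]
  have hsq : ∑ a ∈ (w i).support, ‖(w i).coeff a‖ ^ 2 = ∑ a ∈ S, ‖(w i).coeff a‖ ^ 2 :=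
    Finset.sum_subset (hw i) fun a _ ha => by rw [notMem_support_iff.1 ha, norm_zero]; ring
  rw [hdouble, hsq]
  exact hform (fun a => (w i).coeff a) hzero

end DualBound

end

end Summit.ValiantsHypothesis.ValiantsHypothesis.Theorems.FeketeSOSHardPaleyRIP
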